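import Summits.CriticalPhenomena.CardyFormulaZ2.Theses.CardyMagicRigidity
import Literature.Probability.RandomPlanarGeometry.NestingTransform
import Literature.Probability.RandomPlanarGeometry.LocFinLoopConfig
import Literature.Probability.Percolation.FullPlaneCNL
import Literature.Barriers.CriticalPhenomena.NestingTransformBlindness

/-!
# Skeleton line `positive-cone-weight-doubling` for crux `NestingRigidity` (stmt-CriticalPhenomena-4835)

Route `CardyMagicRigidity`, crux r3 `NestingRigidity` ≡ `MagicFormulaZ2 → MagicFormulaT → LoopLimitZ2EqT`
(literally, `Iff.rfl`; refuter rreview d82cb032): equal Gaussian `cos_{1/6}`-nesting transforms of bond-`ℤ²`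
and site-`𝕋` force `d_CN`-equality of the two full-plane loop ensembles.  crux-plan round 1, planner
`planner-cruxplan-stmt-CriticalPhenomena-4835-positive-cone-weight-0`; idea card
`Cruxes/NestingRigidity/Ideas/positive-cone-weight-doubling.md` (triage r1: pass × 3, merge advice with
`pressure-branch-point`; sharpenings F1/F2 of TRIAGE-r1-1, the "signed scale-1 factor" of TRIAGE-r1-2 and
(a)/(b) of TRIAGE-r1-3 are applied below); line card `Lines/positive-cone-weight-doubling.md`.

## The line

THE LEVER (n = 1 layer, this card + `pressure-branch-point`).  Feed `MagicFormulaZ2` with the neutral test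
density `f = t(ρ_{B(0,r)} − ρ_A)` (normalised small disc minus normalised FIXED ANNULUS `A = {1 ≤ |z| < 2}` —
a bounded density, admissible for the crux as typed; TRIAGE-r1-3 (a)).  The Gaussian side is EXACTLY
`C_t · r^{βt²}`, `β = 3/4π²` (mean-value property of `log` for the annulus).  On the loop side, for
`|t| < π/6` EVERY loop weight `2cos(θ_u + π/3)` is `≥ 0` (positive cone: all partial charges lie in
`(−π/6, π/6)`), the loops surrounding `B̄(0,r)` inside `B(0,1)` carry the tower weight `w(t) = 2cos(t+π/3)`,
and the microscopic loops cutting the disc / the annulus contribute the UV drift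
`exp(−√3 t (E N_disc − E N_annulus)) = exp(−√3 t · E_δ[N(r→1)]) · O(1)` (`δ` cancels by neutrality).  Hence the
SELF-CONSISTENT CONE LAW (`stub_coneScaling`, statement `ConeTiltLawZ2`):
  `E_δ[w(t)^{N(r→1)}] · exp(√3 t E_δ[N(r→1)]) = r^{βt² + o(1)}`,  `|t| < π/6`,
uniformly eventually in the mesh — no scaling limit, no density, no exponent is presupposed.
WEIGHT DOUBLING (`stub_weightDoubling`, statement `NestingDensityZ2`): the involution `t ↦ t' = −t − 2π/3` fixes the
tower weight (`magicWeight_doubling`) but not the Gaussian exponent; at the partner charge `t' ∈ (−5π/6, −π/2)`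
the tower and UV weights are still `≥ 0` and only the O(1) annulus-cutting loops at scale 1 are SIGNED
(TRIAGE F1: the partner is never in the cone) — a signed-scale-1-factor decoupling lemma with non-zero mean
replaces positivity there (TRIAGE-r1-2: no spectral gap / analyticity at `u = 2` is needed, the advantage of
this device over `pressure-branch-point`).  Dividing the two single-radius identities at the same weight gives
`exp(√3 (t' − t) E_δ N) = r^{β(t'² − t²) + o(1)}`, i.e. EXISTENCE AND VALUE of the bond-`ℤ²` nesting density:
`E_δ[N(r→1)] = (ν + o(1)) log(1/r)`, `ν = 2πβ/(3√3) = 1/(2π√3)` (`density_from_doubling`; = 4 × Cardy–Ziff),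
whence the calibrated one-point spectrum `E_δ[w(t)^N] = r^{βt² + t/2π + o(1)} = r^{Δ₆(w(t)) + o(1)}`
(`calibrated_exponent_eq_magicExponent_six`: Schramm–Sheffield–Wilson's CLE₆ exponent, barrier file
`magicExponent_six`; `w = 0⁺`: one-arm `5/48`, DKLM's announced [alpha1]).

THE IDENTIFICATION (n ≥ 2 layers + reconstruction; companions `ring-cloud-tomography`, and the Transfer
"nesting-tree rigidity ⇒ X" shared with `pressure-branch-point`).  `stub_ringTomography` (HARDEST, XL):
calibrated by the n = 1 data, ring-shaped spectator charges (constant log-potential inside: exact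
factorisation on the Gaussian side, arbitrary positive weight profiles on the loop side) make the positively
TILTED multi-disc nesting moments of bond-`ℤ²` and site-`𝕋` agree in the limit on an OPEN set of positive
weights (`PositiveTiltAgreement`); `stub_pgfUniqueness` (M): PGFs with non-negative coefficients agreeing on
an open positive set have equal coefficients, in the limit form (`LawAgreementAt`); `stub_precompactness`
(L): both lattice families are `d_CN`-precompact with a.s. REGULAR subsequential limits (locally finite,
covering degree one, trace = frontier of the winding interior, laminar = NON-CROSSING, separating);
`stub_treeRigidity` (L): along a sequence where both families converge to regular limits, agreement of all
nesting-count laws forces `d_CN(bond_δ, site_δ) → 0` (a regular loop is the frontier of the union of the base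
discs it surrounds; types alternate along the nesting tree and the global bit is a fair coin by
self-duality / colour symmetry).  `NestingRigidity_of` composes the six stubs into the crux BY NAME
(kernel-checked: calibration by modus ponens, `∀ᵐ`-monotonicity, `Filter.tendsto_of_subseq_tendsto`).

    NestingRigidity ⇐ stub_coneScaling ∧ stub_weightDoubling            (n = 1: the lever, ℤ² side)
                     ∧ stub_ringTomography                               (n ≥ 2: tilted moments agree; HARDEST)
                     ∧ stub_pgfUniqueness                                (tilted moments ⇒ count laws)
                     ∧ stub_precompactness ∧ stub_treeRigidity           (count laws + regularity ⇒ d_CN)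

## Disproof used (`Cruxes/NestingRigidity/Disproof.lean` v1.1 = landed barrier
`Literature.Barriers.CriticalPhenomena.NestingTransformBlindness`, p68977; imported above)

* `nestingTransformBlindness_holds` (i) TYPE-blindness (`typed_witness`, `truncNestingWeight_swap`): honoured —
  no stub reads types off a transform; types enter only in `stub_treeRigidity`, from the lattice (alternation
  along the nesting tree + symmetric global bit).
* (ii) POINT-LOOP blindness (`nestingFactor_pointLoop`): honoured — `Regular.boundary` (trace = frontier of the
  winding interior) excludes null-interior loops; it is an OUTPUT of `stub_precompactness` (RSW), not assumed of
  the transform.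
* (iii) COVERING blindness (`untyped_witness`, `le_udist_windLoop_one_two`): honoured — `Regular.degreeOne`
  (`W ∈ {0, ±1}`) is exported by `stub_precompactness` (interface loops are simple on the lattice; winding
  numbers are `udist`-stable) and consumed by `stub_treeRigidity`.
* (iv)+(§5) union multiplicativity / conditional CLE₃⊔CLE₃ impostor (`hasNestingTransform_union`,
  `superposition_half_variance`, `sswMGF_three_eq_six`): honoured and located — the impostor satisfies the
  CONCLUSIONS of `stub_coneScaling`/`stub_weightDoubling` (n = 1 data `2Δ₃ = Δ₆`, `2ν₃ = ν₆`: calibration only,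
  TRIAGE-r1-1/2) but violates `Regular.laminar`; the step that must USE non-crossing is `stub_ringTomography`
  (its hypotheses are the two LATTICE magic formulas, not transform data of an abstract law) together with
  `stub_treeRigidity` (laminar + separating interiors).  No stub quantifies over abstract laws with given
  transform, so no stub is an instance of the refuted principles `not_lawTransformRigidity` /
  `not_fat(Untyped)ConfigTransformRigidity`.
* There is no `_false_without_` theorem for this crux (deleting `MagicFormulaT` leaves `MagicFormulaZ2 → X`,
  believed true); `MagicFormulaT` is used exactly once, at `stub_ringTomography` (the 𝕋 side has the same
  electric data).  Negatives index (`ledger negatives`, 7 items): none concerns loops, nesting or transforms.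
-/

noncomputable section

open MeasureTheory Filter Set Topology
open scoped Real ENNReal BigOperators Classical
open Literature.Probability.RandomPlanarGeometry Literature.Probability.Percolation
  Literature.Probability.LatticeModels
open Summit.CriticalPhenomena.CardyFormulaZ2.Theses.CardyMagicRigidity

namespace Summit.CriticalPhenomena.CardyFormulaZ2.Cruxes.NestingRigidity.PositiveConeWeightDoubling

/-! ### Vocabulary of the line (all over existing declarations) -/

/-- Critical bond percolation on `ℤ²`, `P_{1/2}` (the measure of `MagicFormulaZ2` / `LoopLimitZ2EqT`). -/
abbrev PercZ2 : Measure (BondConfig (Site 2)) := bondPercolation (zdGraph 2) half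

/-- Critical site percolation on `𝕋`, `P_{1/2}` (the measure of `MagicFormulaT` / `LoopLimitZ2EqT`). -/
abbrev PercT : Measure (SiteConfig (Site 2)) := triSitePercolation half

/-- The BKW / DKLM loop weight seen by a loop of charge `t`: `w(t) = cos_{1/6}(t) = 2cos(t + π/3)`
(`= UnbasedLoop.nestingFactor f u` when `u.nestingPhase f = t`). `w(0) = 1`, `w(−π/3) = 2`, `w(π/6) = 0`. -/
def magicWeight (t : ℝ) : ℝ := 2 * Real.cos (t + π / 3)

/-- The Gaussian self-energy coefficient `β = 3/(4π²)` of `MagicFormulaZ2` (`exp(β ∬ log‖x−y‖ f f)`). -/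
def beta : ℝ := 3 / (4 * π ^ 2)

/-- The predicted nesting density of loops per e-fold of scale, `ν = 1/(2π√3) ≈ 0.0919`
(= `1/E[B₆]`, Schramm–Sheffield–Wilson; = 4 × the Cardy–Ziff hull density constant). -/
def nuSix : ℝ := 1 / (2 * π * Real.sqrt 3)

/-- **One-point tower count.** The number of loops (both DKKMO types) of the configuration `c` lying in
the unit window `B(0,1)` whose winding interior `{W ≠ 0}` contains the closed disc `B̄(0,r)`. On a
lattice configuration at positive mesh this is a finite number; `Set.ncard` (junk `0` on infinite sets). -/
def towerCount (c : LoopConfig ℂ) (r : ℝ) : ℕ :=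
  Set.ncard {u ∈ c.loops | u.range ⊆ Metric.ball (0 : ℂ) 1 ∧ Metric.closedBall (0 : ℂ) r ⊆ {z | u.wind z ≠ 0}}

/-- Positively (or signed-) tilted tower moment of bond-`ℤ²` at mesh `δ`: `E_δ[u^{N(r→1)}]`. -/
def towerMomentZ2 (u δ r : ℝ) : ℝ := ∫ ω, u ^ towerCount (bondLoopConfig δ 0 ω) r ∂PercZ2

/-- Mean tower count of bond-`ℤ²` at mesh `δ`: `E_δ[N(r→1)]`. -/
def meanTowerZ2 (δ r : ℝ) : ℝ := ∫ ω, (towerCount (bondLoopConfig δ 0 ω) r : ℝ) ∂PercZ2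

/-- **Multi-disc nesting counts.** For `n` closed discs `B̄(x i, r i)` and a window `B(0,R)`:
`nestCount c x r R S` is the number of loops of `c` inside the window whose winding interior contains every
disc indexed by `S` and whose closed exterior `{W = 0} ∖ trace` contains every disc not indexed by `S`
(loops cutting a disc are not counted anywhere). For `S = ∅` this is junk on continuum configurations and a
huge finite number on lattice ones; statements below only use non-empty `S`. -/
def nestCount {n : ℕ} (c : LoopConfig ℂ) (x : Fin n → ℂ) (r : Fin n → ℝ) (R : ℝ) (S : Finset (Fin n)) : ℕ :=
  Set.ncard {u ∈ c.loops | u.range ⊆ Metric.ball (0 : ℂ) R ∧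
    ∀ i, (i ∈ S → Metric.closedBall (x i) (r i) ⊆ {z | u.wind z ≠ 0}) ∧
      (i ∉ S → Metric.closedBall (x i) (r i) ⊆ {z | u.wind z = 0 ∧ z ∉ u.range})}

/-- The non-empty index sets `∅ ≠ S ⊆ [n]`. -/
def nonemptyParts (n : ℕ) : Finset (Finset (Fin n)) := Finset.univ.filter fun S ↦ S.Nonempty

/-- Tilted multi-disc nesting moment of bond-`ℤ²` at mesh `δ`: `E_δ[∏_{S ≠ ∅} u_S^{N_S}]`. -/
def tiltZ2 {n : ℕ} (x : Fin n → ℂ) (r : Fin n → ℝ) (R : ℝ) (u : Finset (Fin n) → ℝ) (δ : ℝ) : ℝ :=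
  ∫ ω, ∏ S ∈ nonemptyParts n, u S ^ nestCount (bondLoopConfig δ 0 ω) x r R S ∂PercZ2

/-- Tilted multi-disc nesting moment of site-`𝕋` at mesh `δ` (`siteLoopConfig δ` is, definitionally, the
typed configuration written inline in the crux: `siteLoopConfig_eq`). -/
def tiltT {n : ℕ} (x : Fin n → ℂ) (r : Fin n → ℝ) (R : ℝ) (u : Finset (Fin n) → ℝ) (δ : ℝ) : ℝ :=
  ∫ ω, ∏ S ∈ nonemptyParts n, u S ^ nestCount (siteLoopConfig δ ω) x r R S ∂PercT

/-- Cylinder probability of the nesting-count vector `(N_S)_{S ≠ ∅}` of bond-`ℤ²` at mesh `δ`. -/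
def cylZ2 {n : ℕ} (x : Fin n → ℂ) (r : Fin n → ℝ) (R : ℝ) (k : Finset (Fin n) → ℕ) (δ : ℝ) : ℝ :=
  PercZ2.real {ω | ∀ S ∈ nonemptyParts n, nestCount (bondLoopConfig δ 0 ω) x r R S = k S}

/-- Cylinder probability of the nesting-count vector `(N_S)_{S ≠ ∅}` of site-`𝕋` at mesh `δ`. -/
def cylT {n : ℕ} (x : Fin n → ℂ) (r : Fin n → ℝ) (R : ℝ) (k : Finset (Fin n) → ℕ) (δ : ℝ) : ℝ :=
  PercT.real {ω | ∀ S ∈ nonemptyParts n, nestCount (siteLoopConfig δ ω) x r R S = k S}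

/-! ### The lever's outputs (n = 1) -/

/-- **Self-consistent cone law for bond-`ℤ²`** (output of `stub_coneScaling`). For every charge `t` in the
positive cone `(−π/6, π/6)` and every `η > 0`, for all small radii `r` and then all small meshes `δ`:
`r^{βt²+η} ≤ E_δ[w(t)^{N(r→1)}] · exp(√3 t · E_δ[N(r→1)]) ≤ r^{βt²−η}` — the tilted tower moment,
renormalised by the UV drift of the SAME ensemble, has exactly the Gaussian exponent `βt²`. Nothing about a
scaling limit, a nesting density or the existence of exponents is presupposed (at `t = 0` it is trivial). -/
def ConeTiltLawZ2 : Prop :=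
  ∀ t ∈ Set.Ioo (-(π / 6)) (π / 6), ∀ η : ℝ, 0 < η → ∃ r₀ : ℝ, 0 < r₀ ∧ ∀ r ∈ Set.Ioo (0 : ℝ) r₀,
    ∀ᶠ δ in 𝓝[>] (0 : ℝ),
      r ^ (beta * t ^ 2 + η) ≤
          towerMomentZ2 (magicWeight t) δ r * Real.exp (Real.sqrt 3 * t * meanTowerZ2 δ r) ∧
        towerMomentZ2 (magicWeight t) δ r * Real.exp (Real.sqrt 3 * t * meanTowerZ2 δ r) ≤
          r ^ (beta * t ^ 2 - η)

/-- **Nesting density of bond-`ℤ²`** (output of `stub_weightDoubling`): for every `η > 0`, for all small `r`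
and then all small meshes, `(ν − η) log(1/r) ≤ E_δ[N(r→1)] ≤ (ν + η) log(1/r)` with `ν = 1/(2π√3)`:
existence AND value of the mean number of interface loops of `δℤ²` surrounding `B̄(0,r)` inside `B(0,1)`. -/
def NestingDensityZ2 : Prop :=
  ∀ η : ℝ, 0 < η → ∃ r₀ : ℝ, 0 < r₀ ∧ ∀ r ∈ Set.Ioo (0 : ℝ) r₀, ∀ᶠ δ in 𝓝[>] (0 : ℝ),
    (nuSix - η) * Real.log (1 / r) ≤ meanTowerZ2 δ r ∧ meanTowerZ2 δ r ≤ (nuSix + η) * Real.log (1 / r)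

/-! ### The identification statements (n ≥ 2 and reconstruction) -/

/-- **Tilted-moment agreement at one disc configuration**: there is a non-empty OPEN set `U` of positive weight
vectors `(u_S)_{S}` on which the tilted nesting moments of bond-`ℤ²` and site-`𝕋` are eventually bounded and
asymptotically equal as `δ → 0⁺`. -/
def TiltAgreementAt (n : ℕ) (x : Fin n → ℂ) (r : Fin n → ℝ) (R : ℝ) : Prop :=
  ∃ U : Set (Finset (Fin n) → ℝ), IsOpen U ∧ U.Nonempty ∧ (∀ u ∈ U, ∀ S, 0 < u S) ∧
    ∀ u ∈ U, (∃ M : ℝ, ∀ᶠ δ in 𝓝[>] (0 : ℝ), tiltZ2 x r R u δ ≤ M ∧ tiltT x r R u δ ≤ M) ∧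
      Tendsto (fun δ : ℝ ↦ tiltZ2 x r R u δ - tiltT x r R u δ) (𝓝[>] 0) (𝓝 0)

/-- **Law agreement at one disc configuration**: every cylinder probability of the nesting-count vector
`(N_S)_{S ≠ ∅}` has asymptotically the same value on bond-`ℤ²` and on site-`𝕋`. -/
def LawAgreementAt (n : ℕ) (x : Fin n → ℂ) (r : Fin n → ℝ) (R : ℝ) : Prop :=
  ∀ k : Finset (Fin n) → ℕ, Tendsto (fun δ : ℝ ↦ cylZ2 x r R k δ - cylT x r R k δ) (𝓝[>] 0) (𝓝 0)

/-- **Positive tilt agreement** (output of `stub_ringTomography`): for every number of discs and every centre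
vector, for Lebesgue-a.e. positive radius vector and window radius (tangency radii are a null set of
discontinuities of the counts), `TiltAgreementAt` holds. -/
def PositiveTiltAgreement : Prop :=
  ∀ (n : ℕ) (x : Fin n → ℂ), ∀ᵐ p : (Fin n → ℝ) × ℝ, (∀ i, 0 < p.1 i) → 0 < p.2 → TiltAgreementAt n x p.1 p.2

/-- **Nesting-law agreement** (output of `stub_pgfUniqueness` lifted through `∀ᵐ`): for every `n` and centres,
for a.e. radii and window, all cylinder probabilities of `(N_S)_{S ≠ ∅}` agree asymptotically. -/
def NestingLawAgreement : Prop :=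
  ∀ (n : ℕ) (x : Fin n → ℂ), ∀ᵐ p : (Fin n → ℝ) × ℝ, (∀ i, 0 < p.1 i) → 0 < p.2 → LawAgreementAt n x p.1 p.2

/-- **Regularity of a (limit) loop configuration** — the lattice structure that the barrier
`NestingTransformBlindness` says must be USED: local finiteness; covering degree one (`W ∈ {0, ±1}`, kills the
double-circle witness); the trace is the frontier of the winding interior (kills point loops / needles);
LAMINARITY of winding interiors (non-crossing: nested or disjoint — fails for the conditional CLE₃⊔CLE₃
impostor); and distinct loops have distinct interiors up to reversal. -/
structure Regular (c : LoopConfig ℂ) : Prop where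
  /-- finitely many loops of diameter `≥ ε` in every window -/
  locallyFinite : c.IsLocallyFinite
  /-- covering degree one -/
  degreeOne : ∀ u ∈ c.loops, ∀ z : ℂ, u.wind z = 0 ∨ u.wind z = 1 ∨ u.wind z = -1
  /-- the trace is the frontier of the winding interior (no null-interior loops, no two-sided arcs) -/
  boundary : ∀ u ∈ c.loops, u.range = frontier {z | u.wind z ≠ 0}
  /-- non-crossing: winding interiors are nested or disjoint -/
  laminar : ∀ u ∈ c.loops, ∀ v ∈ c.loops,
    {z | u.wind z ≠ 0} ⊆ {z | v.wind z ≠ 0} ∨ {z | v.wind z ≠ 0} ⊆ {z | u.wind z ≠ 0} ∨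
      Disjoint {z | u.wind z ≠ 0} {z | v.wind z ≠ 0}
  /-- distinct loops have distinct interiors (up to orientation) -/
  separating : ∀ u ∈ c.loops, ∀ v ∈ c.loops, {z | u.wind z ≠ 0} = {z | v.wind z ≠ 0} → u = v ∨ u = v.reverse

/-- **`d_CN`-precompactness with regular limits** of a mesh-indexed family of random typed loop
configurations `L δ : Ω → LoopConfig ℂ` under `P`: every mesh sequence `δₖ → 0⁺` has a subsequence along
which the laws converge in DKKMO's coupling distance to SOME law, presented on `([0,1], Leb)`, carried by
regular configurations. -/
def PrecompactRegular {Ω : Type*} [MeasurableSpace Ω] (P : Measure Ω) (L : ℝ → Ω → LoopConfig ℂ) : Prop :=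
  ∀ δs : ℕ → ℝ, Tendsto δs atTop (𝓝[>] (0 : ℝ)) →
    ∃ φ : ℕ → ℕ, StrictMono φ ∧ ∃ X : unitInterval → LoopConfig ℂ,
      (∀ᵐ s : unitInterval, Regular (X s)) ∧
        Tendsto (fun k : ℕ ↦ LoopConfig.cnLawEDist P (L (δs (φ k))) volume X) atTop (𝓝 0)

/-! ### The six stub STATEMENTS (named `Prop`s; the registered `stub_*` theorems restate them verbatim and
`Registered.stub_*` are their name-keyed aliases, the hypotheses of `NestingRigidity_of`) -/

/-- Statement of STUB 1 (the positive cone). -/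
def ConeScaling : Prop := MagicFormulaZ2 → ConeTiltLawZ2

/-- Statement of STUB 2 (weight doubling). -/
def WeightDoubling : Prop := MagicFormulaZ2 → ConeTiltLawZ2 → NestingDensityZ2

/-- Statement of STUB 3 (ring-cloud tomography, calibrated by the n = 1 data; the ONLY use of
`MagicFormulaT`). -/
def RingTomography : Prop :=
  MagicFormulaZ2 → MagicFormulaT → ConeTiltLawZ2 → NestingDensityZ2 → PositiveTiltAgreement

/-- Statement of STUB 4 (PGF uniqueness, pointwise in the disc configuration). -/
def PGFUniqueness : Prop :=
  ∀ (n : ℕ) (x : Fin n → ℂ) (r : Fin n → ℝ) (R : ℝ), TiltAgreementAt n x r R → LawAgreementAt n x r R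

/-- Statement of STUB 5 (precompactness with regular limits, both lattices). -/
def Precompactness : Prop :=
  PrecompactRegular PercZ2 (fun δ ↦ bondLoopConfig δ 0) ∧ PrecompactRegular PercT siteLoopConfig

/-- Statement of STUB 6 (nesting-tree rigidity ⇒ `d_CN`, along a doubly convergent mesh sequence). -/
def TreeRigidity : Prop :=
  ∀ (δs : ℕ → ℝ) (X X' : unitInterval → LoopConfig ℂ), Tendsto δs atTop (𝓝[>] (0 : ℝ)) →
    Tendsto (fun k : ℕ ↦ LoopConfig.cnLawEDist PercZ2 (bondLoopConfig (δs k) 0) volume X) atTop (𝓝 0) →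
    Tendsto (fun k : ℕ ↦ LoopConfig.cnLawEDist PercT (siteLoopConfig (δs k)) volume X') atTop (𝓝 0) →
    (∀ᵐ s : unitInterval, Regular (X s)) → (∀ᵐ s : unitInterval, Regular (X' s)) →
    NestingLawAgreement →
      Tendsto (fun k : ℕ ↦ LoopConfig.cnLawEDist PercZ2 (bondLoopConfig (δs k) 0)
        PercT (siteLoopConfig (δs k))) atTop (𝓝 0)

/-! ### The registered stubs -/

/-- STUB 1 (M–L) — **the positive cone** (`ConeScaling`): `MagicFormulaZ2 → ConeTiltLawZ2`.
Proof route: apply the hypothesis to `f = t(ρ_{B(0,r)} − ρ_A)`, `A = {1 ≤ |z| < 2}` (bounded, measurable,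
compactly supported, mean zero): `Λ_δ(f) → C_t r^{βt²}` exactly (mean-value property of `log` for `ρ_A`,
scaling of `ρ_r`). Loop side, `|t| < π/6`: ALL weights `2cos(θ_u + π/3)` are `≥ 0` (every partial charge lies in
`(−|t|, |t|)`), so the tilted measure is an honest positive measure on non-crossing loop ensembles and
FKG-free quasi-multiplicativity / separation of scales (RSW on `ℤ²`, `ArmSeparation*`, `AnnulusCrossingBound`)
are legal: (a) loops of scale `≍ 1` and `≍ r` contribute O(1) factors uniformly in `δ` and `r`; (b) the
microscopic loops cutting the disc / the annulus contribute `exp(−√3 t Σ_u b_u)(1 + O(Σ b_u²))` with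
`E Σ_u b_u = E_δ[N_disc pt] − E_δ[N_annulus pt] = E_δ[N(r→1)] + O(1)` (translation invariance of `P_{1/2}`:
per-point nesting profiles at scales `≤ r` coincide; `δ` cancels), and concentration of `Σ_u b_u` around its
mean at the exponential scale (per-scale variance `≲ (s/r)²`, summable — the card's falsifier (4)); (c) the
tower factor `w(t)^{N(r→1)}`.  Why it might fail: the drift need not be deterministic to exponential accuracy
(then only a quenched version holds); size M–L (contains no exponent: all exponents sit in `βt²`). -/
theorem stub_coneScaling : MagicFormulaZ2 → ConeTiltLawZ2 := by
  sorry

/-- STUB 2 (M) — **weight doubling** (`WeightDoubling`): `MagicFormulaZ2 → ConeTiltLawZ2 → NestingDensityZ2`.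
Proof route: fix one `t ∈ (−π/6, π/6)` and its partner `t' = −t − 2π/3 ∈ (−5π/6, −π/2)`: `w(t') = w(t) ≥ 0`
(`magicWeight_doubling`).  Run the single-radius identity of STUB 1 at charge `t'`: tower weight and UV weights
(charges `t' b_u`, `b_u` small) are still `≥ 0` and the drift is still `exp(−√3 t' E_δ N)·O(1)`; the ONLY
signed factors are the O(1) loops at scale 1 cutting more than a fraction `≈ 1/5` of the annulus (TRIAGE F1),
handled by a SIGNED-SCALE-1-FACTOR DECOUPLING LEMMA: `E[S₁ · Y] = (E[S₁ | scale-1 σ-field-measurable limit] +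
o(1)) E[Y]`-type factorisation with `lim E[S₁] ≠ 0` (ratio mixing between scale 1 and scales `≤ r`; the
non-vanishing of the mean is checkable on the 𝕋 side and is an RSW-open condition).  Dividing the identities
at `t'` and `t` (same tower weight!) kills the tower moment: `exp(√3 (t' − t) E_δ N) = r^{β(t'² − t²) + o(1)}`,
i.e. `E_δ[N(r→1)] = (2πβ/(3√3) + o(1)) log(1/r) = (ν + o(1)) log(1/r)` (`density_from_doubling`).  Why it might
fail: `lim E[S₁(t')] = 0` for the chosen `t` (then move `t`; it cannot vanish for all `t` by analyticity in
`t`), or the signed decoupling needs a rate.  Size M given STUB 1's machinery. -/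
theorem stub_weightDoubling : MagicFormulaZ2 → ConeTiltLawZ2 → NestingDensityZ2 := by
  sorry

/-- STUB 3 (XL, LOAD-BEARING) — **ring-cloud tomography, calibrated** (`RingTomography`):
`MagicFormulaZ2 → MagicFormulaT → ConeTiltLawZ2 → NestingDensityZ2 → PositiveTiltAgreement`.
The n ≥ 2 layers of the line (companion card `ring-cloud-tomography`, steps (2)–(4)): neutralise charged
multi-disc configurations by RING spectator charges (constant logarithmic potential inside a ring ⇒ the
Gaussian side factorises EXACTLY band by band, `∏_k (L_k/L_{k+1})^{βΛ_k²}`; `RingFactorisation` /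
`ChargedPairPositionIndependence` of `SketchIdeator3.lean` are the provable-now entry identities), so that
the loop side sees an arbitrary piecewise positive weight profile on the nesting towers while all weights and
UV factors stay `≥ 0` for partial charges in `(−π/6, π/6)` (TRIAGE-r1-1 F7 / r1-3: `|a|, |b|, |a+b| < π/6`, an
OPEN set of weights off the "ellipse arc"); the n = 1 calibration (`ConeTiltLawZ2`, `NestingDensityZ2`; the
𝕋-side twins follow by the mirror argument — the lever is lattice-symmetric — or from Camia–Newman + SSW)
cancels every UV drift and every ring self-energy and ring-ring energy in FUSION RATIOS, leaving identities that are
LINEAR in the unknown entrance amplitudes at each layer; both lattices satisfy the same identities, hence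
(uniqueness: "electric rank one / no dark tower modes", to be DERIVED from non-crossing — the conditional
CLE₃⊔CLE₃ impostor of the barrier satisfies every transform identity and is excluded only there) the same
positively tilted moments on an open weight set, for a.e. radii (tangency atoms are Lebesgue-null).  Why it
might fail: electrically dark tower modes for percolation limits (then this stub pins only the electric
sector and `stub_treeRigidity` lacks input); the η-squeeze of the tied top band may cost a rate.  This is
where `MagicFormulaT` is used, and the only place. -/
theorem stub_ringTomography :
    MagicFormulaZ2 → MagicFormulaT → ConeTiltLawZ2 → NestingDensityZ2 → PositiveTiltAgreement := by
  sorry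

/-- STUB 4 (M) — **PGF uniqueness in limit form** (`PGFUniqueness`): at a fixed disc configuration, if the
tilted moments `E[∏ u_S^{N_S}]` of the two lattices are eventually bounded and asymptotically equal for all
weight vectors `u` in a non-empty open subset `U` of the positive orthant, then every cylinder probability of
`(N_S)_{S≠∅}` is asymptotically equal.  Proof route: pass to subsequential limits of the two families of laws
of the `ℕ^{2ⁿ−1}`-valued count vectors (compactness in `[0,1]^ℕ`; the moment bound at a point of `U` with a
smaller point still in `U` gives tightness when some `u_S ≥ 1`, and for `U ⊆ (0,1)^m` sub-probability limits
suffice); the limit PGFs have non-negative coefficients, converge absolutely on the polydisc spanned by a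
point of `U`, and agree on the open set `U` — identity theorem for power series in several variables ⇒ equal
coefficients ⇒ the differences of cylinder probabilities tend to `0` along every subsequence.  Pure analysis /
probability, no percolation; why it might fail: only through a junk-value mismatch (`Measure.real`, `ncard`)
between the two sides, which are typed identically. -/
theorem stub_pgfUniqueness :
    ∀ (n : ℕ) (x : Fin n → ℂ) (r : Fin n → ℝ) (R : ℝ), TiltAgreementAt n x r R → LawAgreementAt n x r R := by
  sorry

/-- STUB 5 (L) — **precompactness with regular limits** (`Precompactness`), for bond-`ℤ²` AND site-`𝕋`:
every mesh sequence has a subsequence along which the typed full-plane loop ensembles converge in `d_CN`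
(`LoopConfig.cnLawEDist`) to a law on `([0,1], Leb)` carried by `Regular` configurations.  Proof route:
Aizenman–Burchard tightness from uniform RSW annulus-crossing bounds (tree: `isTightLaws_map_bondInterface_holds`
is the chordal-interface version on `ℤ²`; `exists_isFullPlaneCNLLaw` + `IsFullPlaneCNLLaw.exists_unitInterval`
give the 𝕋 convergence outright modulo the named Camia–Newman fact), Prokhorov on `CNLoopSpace`
(`levyProkhorovEDist_map_toCN_le_cnLawEDist`) and lifting back to `d_CN` by local finiteness; regularity of
limits: `degreeOne` and `laminar` pass to `udist`-limits of simple nested-or-disjoint lattice loops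
(`UnbasedLoop.wind_eq_or_eq_neg_of_udist_lt`), `boundary`/`separating`/`locallyFinite` from polynomial
6-arm / whole-plane arm bounds (no two macroscopic loops at vanishing distance, no needles).  Why it might
fail: as typed the limit must be presented on `[0,1]` with `Regular` holding a.s. for THIS presentation —
harmless (re-presentation along a measurable map), but `boundary` requires excluding two-sided arcs of limit
loops, a genuine (known-type) arm estimate on both lattices. -/
theorem stub_precompactness :
    PrecompactRegular PercZ2 (fun δ ↦ bondLoopConfig δ 0) ∧ PrecompactRegular PercT siteLoopConfig := by
  sorry

/-- STUB 6 (L) — **nesting-tree rigidity ⇒ `d_CN`** (`TreeRigidity`): along a mesh sequence on which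
bond-`ℤ²` converges to a regular law `X` and site-`𝕋` to a regular law `X'`, agreement of all nesting-count
cylinder probabilities (a.e. radii) forces `d_CN(bond_{δₖ}, site_{δₖ}) → 0`.  Proof route: (1) continuity —
for a.e. radii the counts `N_S` are a.s. continuous at the limit under `d_CN`-convergence (winding numbers are
`udist`-stable off the trace; tangency to a fixed circle is a null event for a.e. radius by Fubini), so `X`
and `X'` have the same joint laws of `(N_S)` over a countable base of rational discs with good radii;
(2) reconstruction — for a `Regular` configuration each loop is recovered from the set of base discs it
surrounds (`{W ≠ 0}` is the union of the base discs inside it, the trace is its frontier: `Regular.boundary`,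
`degreeOne`; distinct loops give distinct sets: `separating`; the multiset of incidence profiles is read off
the counts by `laminar` + local finiteness), measurably, hence the UNTYPED laws of `X`, `X'` coincide up to
`cnEDist = 0`; (3) types — along the nesting tree types alternate (child ≠ parent, exact on both lattices) and
the one remaining global bit is a fair coin independent of the untyped configuration (self-duality of
bond-`ℤ²` at `1/2` up to a `δ/2` shift, colour-flip symmetry of site-`𝕋`: `(U, B) =ᵈ (U, ¬B)`), so the TYPED
laws coincide: `cnLawEDist volume X volume X' = 0`; (4) gluing — `cnLawEDist_triangle` twice
(`standardBorelSpace_bondConfig`, `standardBorelSpace_siteConfig`, `measurableSet_isClose_of_gen` with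
`gen_bondLoopConfig` / `gen_siteLoopConfig`; re-present `X`, `X'` measurably if needed).  This is where the
barrier's blind spots (types, null loops, covering multiplicity, superpositions) are paid for with lattice
structure.  Why it might fail: step (2) needs that a.e.-radius incidence data pin PARAMETRISED loops, i.e.
that regular limit loops with equal traces are reparametrisations of each other (true for loops whose trace
is the frontier of a laminar family of Jordan-like interiors; CLE₆-type pinch points need care). -/
theorem stub_treeRigidity :
    ∀ (δs : ℕ → ℝ) (X X' : unitInterval → LoopConfig ℂ), Tendsto δs atTop (𝓝[>] (0 : ℝ)) →
      Tendsto (fun k : ℕ ↦ LoopConfig.cnLawEDist PercZ2 (bondLoopConfig (δs k) 0) volume X) atTop (𝓝 0) →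
      Tendsto (fun k : ℕ ↦ LoopConfig.cnLawEDist PercT (siteLoopConfig (δs k)) volume X') atTop (𝓝 0) →
      (∀ᵐ s : unitInterval, Regular (X s)) → (∀ᵐ s : unitInterval, Regular (X' s)) →
      NestingLawAgreement →
        Tendsto (fun k : ℕ ↦ LoopConfig.cnLawEDist PercZ2 (bondLoopConfig (δs k) 0)
          PercT (siteLoopConfig (δs k))) atTop (𝓝 0) := by
  sorry

/-! ### Consistency: each named statement IS its registered stub (definitionally) -/

theorem coneScaling_holds : ConeScaling := stub_coneScaling
theorem weightDoubling_holds : WeightDoubling := stub_weightDoubling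
theorem ringTomography_holds : RingTomography := stub_ringTomography
theorem pgfUniqueness_holds : PGFUniqueness := stub_pgfUniqueness
theorem precompactness_holds : Precompactness := stub_precompactness
theorem treeRigidity_holds : TreeRigidity := stub_treeRigidity

/-! ### Name-keyed aliases of the six statements (the hypotheses of the composition)

`Registered.stub_X` is statement `X` under the registered stub's short name, so that the native skeleton
audit (`#h21_check_skeleton`: hypotheses admissible iff route items or declared stubs BY NAME) accepts
`NestingRigidity_of : Registered.stub_coneScaling → … → NestingRigidity` (same device as
`Cruxes/LagHandOff/Lines/crosscut-dictionary.lean`). -/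
namespace Registered

/-- Alias of `ConeScaling` keyed by the registered stub name. -/
abbrev stub_coneScaling : Prop := ConeScaling
/-- Alias of `WeightDoubling` keyed by the registered stub name. -/
abbrev stub_weightDoubling : Prop := WeightDoubling
/-- Alias of `RingTomography` keyed by the registered stub name. -/
abbrev stub_ringTomography : Prop := RingTomography
/-- Alias of `PGFUniqueness` keyed by the registered stub name. -/
abbrev stub_pgfUniqueness : Prop := PGFUniqueness
/-- Alias of `Precompactness` keyed by the registered stub name. -/
abbrev stub_precompactness : Prop := Precompactness
/-- Alias of `TreeRigidity` keyed by the registered stub name. -/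
abbrev stub_treeRigidity : Prop := TreeRigidity

end Registered

/-! ### The lever's algebra, proved (weight doubling, exponent gap, the density, the calibration) -/

/-- **Weight doubling**: the involution `t ↦ −t − 2π/3` fixes the loop weight. -/
theorem magicWeight_doubling (t : ℝ) : magicWeight (-t - 2 * π / 3) = magicWeight t := by
  unfold magicWeight
  rw [show -t - 2 * π / 3 + π / 3 = -(t + π / 3) by ring, Real.cos_neg]

/-- … but NOT the Gaussian exponent: `β(t'² − t²) = (t + π/3)/π` is linear in `t`. -/
theorem exponent_gap (t : ℝ) : beta * ((-t - 2 * π / 3) ^ 2 - t ^ 2) = (t + π / 3) / π := by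
  unfold beta
  have hπ : π ≠ 0 := Real.pi_ne_zero
  field_simp
  ring

/-- The tower weight at the partner charge is still non-negative when `t` is in the cone
(`t' + π/3 = −(t + π/3) ∈ (−π/2, π/2)`), as is the tower weight in the cone itself. -/
theorem magicWeight_nonneg_of_mem_cone {t : ℝ} (ht : t ∈ Set.Ioo (-(π / 6)) (π / 6)) :
    0 ≤ magicWeight t ∧ 0 ≤ magicWeight (-t - 2 * π / 3) := by
  rw [magicWeight_doubling]
  refine (and_self_iff).2 ?_
  unfold magicWeight
  refine mul_nonneg (by norm_num) (Real.cos_nonneg_of_mem_Icc ⟨?_, ?_⟩)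
  · linarith [ht.1, Real.pi_pos]
  · linarith [ht.2, Real.pi_pos]

/-- **The density from weight doubling**: dividing the single-radius identities at `t'` and `t` gives
`E N = β (t + t') / √3 · log r = (2πβ/(3√3)) log(1/r)`, and `2πβ/(3√3) = 1/(2π√3) = ν`. -/
theorem density_from_doubling : 2 * π * beta / (3 * Real.sqrt 3) = nuSix := by
  unfold beta nuSix
  have hπ : π ≠ 0 := Real.pi_ne_zero
  have h3 : Real.sqrt 3 ≠ 0 := by positivity
  field_simp
  ring

/-- `√3 ν = 1/(2π)`: the calibrated UV drift coefficient. -/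
theorem sqrt_three_mul_nuSix : Real.sqrt 3 * nuSix = 1 / (2 * π) := by
  unfold nuSix
  have hπ : π ≠ 0 := Real.pi_ne_zero
  have h3 : Real.sqrt 3 ≠ 0 := by positivity
  field_simp

/-- **Calibration = SSW**: once the density is `ν`, the cone law reads `E[w(t)^N] = r^{βt² + t/2π + o(1)}`, and
`βt² + t/2π` is exactly the CLE₆ magic exponent `Δ₆(t)` of the barrier file
(`Literature.Barriers.CriticalPhenomena.NestingBlind.magicExponent_six`; `t = π/6`: one-arm `5/48`, `t = −π/3`: `−1/12`). -/
theorem calibrated_exponent_eq_magicExponent_six (t : ℝ) :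
    beta * t ^ 2 + t / (2 * π) = Literature.Barriers.CriticalPhenomena.NestingBlind.magicExponent 6 t := by
  rw [Literature.Barriers.CriticalPhenomena.NestingBlind.magicExponent_six]
  unfold beta
  ring

/-! ### The composition: the six stubs imply the crux, by name -/

/-- `NestingRigidity` from the six stubs (pure logic + `Filter.tendsto_of_subseq_tendsto`; no `sorry`).
Given the crux's antecedents `MagicFormulaZ2` (hZ) and `MagicFormulaT` (hT): STUBS 1–2 calibrate
(`ConeTiltLawZ2`, `NestingDensityZ2`) from hZ; STUB 3 (+ hT) gives positive tilt agreement; STUB 4 turns it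
into nesting-law agreement (a.e. radii, `Eventually.mono`); then `d_CN(bond_δ, site_δ) → 0` because every
mesh sequence `δₖ → 0⁺` has, by STUB 5 applied to bond-`ℤ²` and then to site-`𝕋` along the extracted
subsequence, a sub-subsequence on which both families converge to regular laws, and STUB 6 concludes along
it.  The conclusion is the route decl itself (`LoopLimitZ2EqT` unfolds to the `d_CN` statement with the
inline 𝕋 configuration `= siteLoopConfig δ` by `rfl`). -/
theorem NestingRigidity_of (h₁ : Registered.stub_coneScaling) (h₂ : Registered.stub_weightDoubling)
    (h₃ : Registered.stub_ringTomography) (h₄ : Registered.stub_pgfUniqueness)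
    (h₅ : Registered.stub_precompactness) (h₆ : Registered.stub_treeRigidity) :
    Summit.CriticalPhenomena.CardyFormulaZ2.Theses.CardyMagicRigidity.NestingRigidity := by
  intro hZ hT
  have hcone : ConeTiltLawZ2 := h₁ hZ
  have hdens : NestingDensityZ2 := h₂ hZ hcone
  have htilt : PositiveTiltAgreement := h₃ hZ hT hcone hdens
  have hlaw : NestingLawAgreement := fun n x ↦
    (htilt n x).mono fun p hp hr hR ↦ h₄ n x p.1 p.2 (hp hr hR)
  obtain ⟨hpZ, hpT⟩ := h₅
  change Tendsto (fun δ : ℝ ↦ LoopConfig.cnLawEDist PercZ2 (bondLoopConfig δ 0) PercT (siteLoopConfig δ))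
    (𝓝[>] 0) (𝓝 0)
  refine Filter.tendsto_of_subseq_tendsto fun δs hδs ↦ ?_
  obtain ⟨φ, hφ, X, hXreg, hXlim⟩ := hpZ δs hδs
  have hδs' : Tendsto (δs ∘ φ) atTop (𝓝[>] (0 : ℝ)) := hδs.comp hφ.tendsto_atTop
  obtain ⟨ψ, hψ, X', hX'reg, hX'lim⟩ := hpT (δs ∘ φ) hδs'
  have hδs'' : Tendsto (δs ∘ φ ∘ ψ) atTop (𝓝[>] (0 : ℝ)) := hδs'.comp hψ.tendsto_atTop
  have hXlim' : Tendsto (fun k : ℕ ↦ LoopConfig.cnLawEDist PercZ2 (bondLoopConfig ((δs ∘ φ ∘ ψ) k) 0)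
      volume X) atTop (𝓝 0) := hXlim.comp hψ.tendsto_atTop
  have hX'lim' : Tendsto (fun k : ℕ ↦ LoopConfig.cnLawEDist PercT (siteLoopConfig ((δs ∘ φ ∘ ψ) k))
      volume X') atTop (𝓝 0) := hX'lim
  exact ⟨φ ∘ ψ, h₆ (δs ∘ φ ∘ ψ) X X' hδs'' hXlim' hX'lim' hXreg hX'reg hlaw⟩

/-- Wiring check: the registered stubs feed `NestingRigidity_of` as stated. -/
example : Summit.CriticalPhenomena.CardyFormulaZ2.Theses.CardyMagicRigidity.NestingRigidity :=
  NestingRigidity_of stub_coneScaling stub_weightDoubling stub_ringTomography stub_pgfUniqueness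
    stub_precompactness stub_treeRigidity

end Summit.CriticalPhenomena.CardyFormulaZ2.Cruxes.NestingRigidity.PositiveConeWeightDoubling

end
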